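import Summits.ABC.ABC.Theses.IsogenyGlueCongruence
import Summits.ABC.ABC.Theorems.IsogenyGlueCongruencePolyHeightOfBoundedPrimesHallSplit
import Summits.ABC.ABC.Theorems.IsogenyGlueCongruencePolyHeightOfBoundedPrimesHallSplitExact
import Summits.ABC.ABC.Theorems.IsogenyGlueCongruencePolyHeightOfBoundedPrimesHallSplitPosition
import Summits.ABC.ABC.Theorems.IsogenyGlueCongruencePolyHeightOfBoundedPrimesStubPolyHallDeltaOfPolyHall
import Summits.ABC.ABC.Theorems.IsogenyGlueCongruencePolyHeightOfBoundedPrimesStubPolyAbcOfPolySzpiroDelta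
import Summits.ABC.ABC.Theorems.IsogenyGlueCongruencePolyHeightOfBoundedPrimesStubPolyHallDeltaFrey
import Summits.ABC.ABC.Theorems.IsogenyGlueCongruencePolyHeightOfBoundedPrimesStubPrimeConductorRung
import Summits.ABC.ABC.Theorems.IsogenyGlueCongruencePolyHeightOfBoundedPrimesStubHallHalfAllIffWeakHall
import Summits.ABC.ABC.Theorems.IsogenyGlueCongruencePolyHeightOfBoundedPrimesStubHallHalfIffPolyJ

/-!
# Line `Sketch` (idea `archimedean-hall-split`, ideator 1) for crux stmt-ABC-16006
`PolyHeightOfBoundedPrimes` — lead's skeleton v3 (prover-line-stmt-ABC-16006-c1-0, 2026-08-16; cycle 1: 9 of 11 registered stubs LANDED — everything except the two cores)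

The crux is `B′ = A → H` (`A = DegreePrimesPolyBounded`; `H` = the polynomial height conjecture for
semistable globally minimal elliptic `W/ℚ`: `max(|Δ_W|, |c₄(W)|³) ≤ C · N_W^σ`, exponent free).
The line (planner's `Ideator1Sketch.lean`, card `Ideas/archimedean-hall-split.md`, reshaped by the
lead) splits the consequent along finite / archimedean places:

* **CORE STUB 1 (finite half, conjecture-grade; lead)** `stub_polySzpiroDelta` = `PolySzpiroΔ`:
  `|Δ_W| ≤ C · N_W^σ` on semistable global minimal models (discriminant-form polynomial Szpiro;
  floor `σ > 6`, `Negative.six_lt_of_polySzpiroΔAt`, p121766; implies polynomial abc on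
  normalised triples, `stub_polyAbc_of_polySzpiroDelta`).
* **CORE STUB 2 (archimedean / Hall half, conjecture-grade; lead)** `stub_polyHallDelta` =
  `PolyHallΔ`: `|c₄(W)|³ ≤ C · |Δ_W|^{σ'}`, `0 ≤ σ'` — polynomial Hall for the integral points
  `(c₄, c₆)` on the Mordell curves `Y² = X³ − 1728Δ`; `N`-free; floor `σ' ≥ 3/2` (Frey family,
  `Negative.three_halves_le_of_polyHallAt`, p121660); implied by ANY power-saving weak Hall bound
  (`stub_polyHallDelta_of_polyHall`); void on the Frey locus (`stub_polyHallDelta_frey`).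
* proved glue `polyHeight_of_split` (both halves ⟹ `H`, exponent `σ₁⁺(1 + σ')`) and the composition
  `PolyHeightOfBoundedPrimes_of : PolyHeightOfBoundedPrimes` — closes the crux BY NAME modulo the two
  cores; hypothesis `A` idle (Disproof §2e: `abstract_iff_H`, `calibrated_iff_H`).
* transfer stub `stub_polyHeightOfBoundedPrimes_of_split` (C⁺ = PolySzpiroΔ ∧ PolyHallΔ ⟹ crux; PROVED here).
  With the landed converse `Negative.split_of_polyHeight` (p122124) the transfer target is EXACTLY `H`:
  `polyHeight_iff_split`.

AFTER CYCLE 1 THE ONLY `sorry`S LEFT ARE THE TWO CORES (conjecture-grade). Landed: transfer p122489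
(`Theorems/IsogenyGlueCongruencePolyHeightOfBoundedPrimesHallSplit.lean`), calibration p122623, p122592,
p122715, p122680, p123281, p123009 (`Theorems/IsogenyGlueCongruencePolyHeightOfBoundedPrimesStub*.lean`), exactness p123481
(`…HallSplitExact.lean`), position p123682 (`…HallSplitPosition.lean`); namespace `Summit.ABC.ABC.Theorems.PolyHeightOfBoundedPrimes.HallSplit`.

POSITION OF THE CORES after cycle 1 (all kernel-checked): finite half ⟸ `H` ⟸ abc, ⟹ polynomial abc on
normalised triples (p122592), floor `σ > 6`; Hall half ⟸ weak Hall with any exponent (p122623), and WITH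
SEMISTABILITY DROPPED it is EXACTLY the free-exponent Hall conjecture (`stub_hallHalfAll_iff_weakHall`, p123281),
j-form `log⁺|j| ≤ σ' log|Δ_min| + O(1)` (p123009), void on the Frey locus (`σ' = 3/2`, p122715), floor `σ' ≥ 3/2`;
at prime conductor `H` ⟺ Hall half modulo Mestre–Oesterlé (p122680). Both cores are open conjectures in print.

CALIBRATION / POSITION stubs (registered, NOT in the cone; def-free so they land verbatim) — ALL LANDED:
* `stub_polyHallDelta_of_polyHall` — engine interface of the Hall half: a weak Hall inequality with ANY
  exponent `θ > 0` (`c·|x|^θ ≤ |x³ − y²|` for `x³ ≠ y²`) gives `PolyHallΔ` with `σ' = 3/θ`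
  (integrality of `c₄, c₆, Δ` on a global minimal model, `1728Δ = c₄³ − c₆²`).
* `stub_polyAbc_of_polySzpiroDelta` — the finite half ALONE carries polynomial abc on Serre-normalised
  triples (Frey curve `freyIntModel₂`, `Δ_min = (AB(A+B))²/2⁸`, `N = rad`), cf. `polyAbcNormalized_of_polyHeight`.
* `stub_polyHallDelta_frey` — on the Frey locus the Hall half holds identically with `σ' = 3/2`:
  every global minimal model `W` of `freyCurve A B` (normalised) has `|c₄(W)|³ = (A²+AB+B²)³ ≤ 2²⁰·|Δ_W|^{3/2}`.
* `stub_primeConductorRung` — modulo the named fact `mestreOesterle1989_thm_1` (prime conductor ⟹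
  `Δ_min ∣ N⁵`, Literature, undischarged) the finite half is KNOWN at prime conductor, so there `H`
  reduces to the Hall half: Hall half at prime conductor ⟹ `H` at prime conductor (exponent `5·max(σ',1)`).
* `stub_hallHalfAll_iff_weakHall` (cycle-1 wave 2) — with `IsSemistable` dropped the Hall half is EXACTLY the
  free-exponent Hall conjecture (`→`: the model `Y² = X³ − 27xX − 54y`, its global minimal model, `|u| ≥ 1`).
* `stub_hallHalf_iff_polyJ` (cycle-1 wave 2) — the Hall half in `j`-form (`|j| ≤ C|Δ|^{σ'}`, exponent shift 1).
* `stub_polyHeight_iff_split` (exactness, lead) — `H ↔ PolySzpiroΔ ∧ PolyHallΔ`; `stub_hallHalf_of_target` (position,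
  lead) — the route target `X` implies the Hall half.

All stub signatures are def-free (they land verbatim as `--supports` theorems).
-/

noncomputable section

-- single-conjunct summit ABC: the duplicate ABC.ABC is mandated (CONVENTIONS §2)
set_option linter.dupNamespace false

namespace Summit.ABC.ABC.Cruxes.PolyHeightOfBoundedPrimes.HallSplit

open IsDedekindDomain WeierstrassCurve
open Literature.NumberTheory.EllipticCurves
open Summit.ABC.ABC.Theses.IsogenyGlueCongruence

/-! ## Registered core stubs (the cone) -/

/-- **CORE STUB 1 (finite half `PolySzpiroΔ`, conjecture-grade; lead).** Discriminant-form polynomial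
Szpiro for semistable curves: `|Δ_W| ≤ C · N_W^σ` on global minimal models. OPEN in print (abc-strength:
⟹ polynomial abc on normalised triples, `stub_polyAbc_of_polySzpiroDelta`; ⟸ `H` ⟸ abc); floor `σ > 6`. -/
theorem stub_polySzpiroDelta :
    ∃ σ C : ℝ, ∀ (W : WeierstrassCurve ℚ) [W.IsElliptic] [W.IsGloballyMinimal]
      [NeZero (W.conductorNorm ℤ)], W.IsSemistable ℤ →
        ((|W.Δ| : ℚ) : ℝ) ≤ C * (W.conductorNorm ℤ : ℝ) ^ σ := by
  sorry

/-- **CORE STUB 2 (Hall half `PolyHallΔ`, conjecture-grade; lead).** The archimedean exponent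
`log⁺|j| = log|c₄|³ − log|Δ|` is polynomially dominated by the finite ones: `|c₄(W)|³ ≤ C · |Δ_W|^{σ'}`,
`0 ≤ σ'`, on semistable global minimal models. OPEN in print (no power-saving Hall bound is known,
Elkies 2000 §4.1); ⟸ weak Hall with any exponent (`stub_polyHallDelta_of_polyHall`); floor `σ' ≥ 3/2`. -/
theorem stub_polyHallDelta :
    ∃ σ C : ℝ, 0 ≤ σ ∧ ∀ (W : WeierstrassCurve ℚ) [W.IsElliptic] [W.IsGloballyMinimal]
      [NeZero (W.conductorNorm ℤ)], W.IsSemistable ℤ →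
        ((|W.c₄| ^ 3 : ℚ) : ℝ) ≤ C * ((|W.Δ| : ℚ) : ℝ) ^ σ := by
  sorry

/-! ## Proved glue and the composition -/

/-- **Both halves give `H`** (the card's first lemma; LANDED p122489 as
`Summit.ABC.ABC.Theorems.PolyHeightOfBoundedPrimes.HallSplit.polyHeight_of_split`): `|Δ| ≤ C₁N^{σ₁}` and
`|c₄|³ ≤ C₂|Δ|^{σ₂}` give `max(|Δ|, |c₄|³) ≤ (C₁' + C₂'C₁'^{σ₂}) · N^{σ₁' + σ₁'σ₂}`. [folklore] -/
theorem polyHeight_of_split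
    (hΔ : ∃ σ C : ℝ, ∀ (W : WeierstrassCurve ℚ) [W.IsElliptic] [W.IsGloballyMinimal]
      [NeZero (W.conductorNorm ℤ)], W.IsSemistable ℤ →
        ((|W.Δ| : ℚ) : ℝ) ≤ C * (W.conductorNorm ℤ : ℝ) ^ σ)
    (hHall : ∃ σ C : ℝ, 0 ≤ σ ∧ ∀ (W : WeierstrassCurve ℚ) [W.IsElliptic] [W.IsGloballyMinimal]
      [NeZero (W.conductorNorm ℤ)], W.IsSemistable ℤ →
        ((|W.c₄| ^ 3 : ℚ) : ℝ) ≤ C * ((|W.Δ| : ℚ) : ℝ) ^ σ) :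
    ∃ σ C : ℝ, ∀ (W : WeierstrassCurve ℚ) [W.IsElliptic] [W.IsGloballyMinimal]
      [NeZero (W.conductorNorm ℤ)], W.IsSemistable ℤ →
        ((max |W.Δ| (|W.c₄| ^ 3) : ℚ) : ℝ) ≤ C * (W.conductorNorm ℤ : ℝ) ^ σ :=
  Summit.ABC.ABC.Theorems.PolyHeightOfBoundedPrimes.HallSplit.polyHeight_of_split hΔ hHall

/-- **The composition: the line closes the crux BY NAME** modulo the two cores in its cone
(`stub_polySzpiroDelta`, `stub_polyHallDelta`). `A` is idle. [folklore] -/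
theorem PolyHeightOfBoundedPrimes_of : PolyHeightOfBoundedPrimes :=
  fun _ ↦ polyHeight_of_split stub_polySzpiroDelta stub_polyHallDelta

-- TRANSFER STUB `stub_polyHeightOfBoundedPrimes_of_split : PolySzpiroΔ → PolyHallΔ → PolyHeightOfBoundedPrimes`
-- (= the composition minus its cores, `fun hΔ hHall _ ↦ polyHeight_of_split hΔ hHall`) is registered via
-- `stub-add` and LANDED p122489 as `Summit.ABC.ABC.Theorems.PolyHeightOfBoundedPrimes.HallSplit.stub_polyHeightOfBoundedPrimes_of_split`
-- (`Theorems/IsogenyGlueCongruencePolyHeightOfBoundedPrimesHallSplit.lean`); it is not restated here so that exactly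
-- one theorem of this file concludes the crux (the skeleton checker's rule).

/-- **EXACTNESS STUB (registered via `stub-add`, LANDED p123481): the transfer target is exactly `H`**,
`H ↔ PolySzpiroΔ ∧ PolyHallΔ` (`→` = the disprover's `Negative.split_of_polyHeight`, p122124, from
`1 ≤ N_W ≤ |Δ_W|`; `←` = `polyHeight_of_split`). So the line isolates two difficulties of `H` without adding
strength, and the landed floors of the halves bind every split proof. [folklore] -/
theorem stub_polyHeight_iff_split :
    (∃ σ C : ℝ, ∀ (W : WeierstrassCurve ℚ) [W.IsElliptic] [W.IsGloballyMinimal]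
      [NeZero (W.conductorNorm ℤ)], W.IsSemistable ℤ →
        ((max |W.Δ| (|W.c₄| ^ 3) : ℚ) : ℝ) ≤ C * (W.conductorNorm ℤ : ℝ) ^ σ) ↔
    ((∃ σ C : ℝ, ∀ (W : WeierstrassCurve ℚ) [W.IsElliptic] [W.IsGloballyMinimal]
      [NeZero (W.conductorNorm ℤ)], W.IsSemistable ℤ →
        ((|W.Δ| : ℚ) : ℝ) ≤ C * (W.conductorNorm ℤ : ℝ) ^ σ) ∧
    (∃ σ C : ℝ, 0 ≤ σ ∧ ∀ (W : WeierstrassCurve ℚ) [W.IsElliptic] [W.IsGloballyMinimal]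
      [NeZero (W.conductorNorm ℤ)], W.IsSemistable ℤ →
        ((|W.c₄| ^ 3 : ℚ) : ℝ) ≤ C * ((|W.Δ| : ℚ) : ℝ) ^ σ)) :=
  -- LANDED p123481 (lead): Theorems/IsogenyGlueCongruencePolyHeightOfBoundedPrimesHallSplitExact.lean
  Summit.ABC.ABC.Theorems.PolyHeightOfBoundedPrimes.HallSplit.stub_polyHeight_iff_split

/-! ## Calibration / position stubs (registered; not in the cone) -/

/-- **CALIBRATION STUB (engine interface of the Hall half).** A weak Hall inequality with ANY exponent
`θ > 0` — `c · |x|^θ ≤ |x³ − y²|` for all integers with `x³ ≠ y²` — gives the Hall half with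
`σ' = 3/θ`, `C = (1728/c)^{3/θ}`: on the integral global minimal model `1728Δ = c₄³ − c₆² ≠ 0`.
The Hall half is thus a pure Diophantine statement about Mordell curves (`N` does not occur). -/
theorem stub_polyHallDelta_of_polyHall :
    (∃ θ c : ℝ, 0 < θ ∧ 0 < c ∧ ∀ x y : ℤ, x ^ 3 ≠ y ^ 2 →
      c * |(x : ℝ)| ^ θ ≤ |((x : ℝ) ^ 3 - (y : ℝ) ^ 2)|) →
    ∃ σ C : ℝ, 0 ≤ σ ∧ ∀ (W : WeierstrassCurve ℚ) [W.IsElliptic] [W.IsGloballyMinimal]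
      [NeZero (W.conductorNorm ℤ)], W.IsSemistable ℤ →
        ((|W.c₄| ^ 3 : ℚ) : ℝ) ≤ C * ((|W.Δ| : ℚ) : ℝ) ^ σ :=
  -- LANDED p122623 (worker W1): Theorems/IsogenyGlueCongruencePolyHeightOfBoundedPrimesStubPolyHallDeltaOfPolyHall.lean
  Summit.ABC.ABC.Theorems.PolyHeightOfBoundedPrimes.HallSplit.stub_polyHallDelta_of_polyHall

/-- **CALIBRATION STUB (position of the finite half).** `PolySzpiroΔ` alone gives polynomial abc on
Serre-normalised triples: `(AB(A+B))² ≤ C · N^σ` with `N` the conductor of `freyCurve A B`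
(`= rad(AB(A+B))`), through the global minimal model `freyIntModel₂ A B ⊗ ℚ`
(`Δ = (AB/16)²(A+B)²`, semistable, same conductor). Cf. `polyAbcNormalized_of_polyHeight` (p111354),
which uses only the `Δ`-component of `H`. -/
theorem stub_polyAbc_of_polySzpiroDelta :
    (∃ σ C : ℝ, ∀ (W : WeierstrassCurve ℚ) [W.IsElliptic] [W.IsGloballyMinimal]
      [NeZero (W.conductorNorm ℤ)], W.IsSemistable ℤ →
        ((|W.Δ| : ℚ) : ℝ) ≤ C * (W.conductorNorm ℤ : ℝ) ^ σ) →
    ∃ σ C : ℝ, ∀ A B : ℤ, IsCoprime A B → A * B * (A + B) ≠ 0 → A ≡ -1 [ZMOD 4] → (32 : ℤ) ∣ B →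
      (((A * B * (A + B)) ^ 2 : ℤ) : ℝ) ≤ C * ((freyCurve A B).conductorNorm ℤ : ℝ) ^ σ :=
  -- LANDED p122592 (worker W2): Theorems/IsogenyGlueCongruencePolyHeightOfBoundedPrimesStubPolyAbcOfPolySzpiroDelta.lean
  Summit.ABC.ABC.Theorems.PolyHeightOfBoundedPrimes.HallSplit.stub_polyAbc_of_polySzpiroDelta

/-- **CALIBRATION STUB (the Hall half is void on the Frey locus, `σ' = 3/2`).** For a Serre-normalised
pair (`A, B` coprime, `AB(A+B) ≠ 0`, `A ≡ −1 (mod 4)`, `32 ∣ B`) every global minimal model `W` of the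
Frey curve has `|c₄(W)|³ = (A² + AB + B²)³` and `|Δ_W| = (AB(A+B))²/2⁸`, whence
`|c₄(W)|³ ≤ 216·|AB(A+B)|³ = 2¹²·216·|Δ_W|^{3/2} ≤ 2²⁰·|Δ_W|^{3/2}`
(`A² + AB + B² ≤ 3·max² ≤ 6·|AB(A+B)|`). -/
theorem stub_polyHallDelta_frey :
    ∀ A B : ℤ, IsCoprime A B → A * B * (A + B) ≠ 0 → A ≡ -1 [ZMOD 4] → (32 : ℤ) ∣ B →
      ∀ (W : WeierstrassCurve ℚ) [W.IsElliptic] [W.IsGloballyMinimal],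
        (∃ C : WeierstrassCurve.VariableChange ℚ, C • freyCurve A B = W) →
          ((|W.c₄| ^ 3 : ℚ) : ℝ) ≤ 2 ^ 20 * ((|W.Δ| : ℚ) : ℝ) ^ (3 / 2 : ℝ) :=
  -- LANDED p122715 (worker W3): Theorems/IsogenyGlueCongruencePolyHeightOfBoundedPrimesStubPolyHallDeltaFrey.lean
  Summit.ABC.ABC.Theorems.PolyHeightOfBoundedPrimes.HallSplit.stub_polyHallDelta_frey

/-- **CALIBRATION STUB (prime-conductor rung).** Modulo the named fact
`Literature.NumberTheory.DiophantineGeometry.mestreOesterle1989_thm_1` (prime conductor ⟹ `Δ_min ∣ N⁵`;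
Mestre–Oesterlé 1989, Knapp Thm 12.11) the finite half is KNOWN at prime conductor (`σ = 5`), so there the
consequent `H` reduces to the Hall half: a Hall bound `|c₄|³ ≤ C·|Δ|^{σ'}` on prime-conductor global
minimal models gives `max(|Δ|, |c₄|³) ≤ max(1, C) · N^{5·max(σ',1)}`. -/
theorem stub_primeConductorRung :
    Literature.NumberTheory.DiophantineGeometry.mestreOesterle1989_thm_1 →
    ∀ σ C : ℝ, 0 ≤ σ → 0 ≤ C →
      (∀ (W : WeierstrassCurve ℚ) [W.IsElliptic] [W.IsGloballyMinimal],
        (W.conductorNorm ℤ).Prime → ((|W.c₄| ^ 3 : ℚ) : ℝ) ≤ C * ((|W.Δ| : ℚ) : ℝ) ^ σ) →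
      ∀ (W : WeierstrassCurve ℚ) [W.IsElliptic] [W.IsGloballyMinimal],
        (W.conductorNorm ℤ).Prime →
          ((max |W.Δ| (|W.c₄| ^ 3) : ℚ) : ℝ) ≤ max 1 C * (W.conductorNorm ℤ : ℝ) ^ (5 * max σ 1) :=
  -- LANDED p122680 (worker W4): Theorems/IsogenyGlueCongruencePolyHeightOfBoundedPrimesStubPrimeConductorRung.lean
  Summit.ABC.ABC.Theorems.PolyHeightOfBoundedPrimes.HallSplit.stub_primeConductorRung

/-- **CALIBRATION STUB (semistability dropped: the Hall half is the weak Hall conjecture).** Over ALL global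
minimal elliptic `W/ℚ`, `|c₄|³ ≤ C|Δ|^{σ'}` holds for some `(σ', C)` iff the free-exponent Hall inequality
`c|x|^θ ≤ |x³ − y²|` (`x³ ≠ y²`) holds for some `θ, c > 0`. So `IsSemistable` (⟺ `gcd(c₄, Δ_min) = 1`) is the
only structure the line's Hall half has beyond Hall's problem. -/
theorem stub_hallHalfAll_iff_weakHall :
    (∃ σ C : ℝ, 0 ≤ σ ∧ ∀ (W : WeierstrassCurve ℚ) [W.IsElliptic] [W.IsGloballyMinimal],
        ((|W.c₄| ^ 3 : ℚ) : ℝ) ≤ C * ((|W.Δ| : ℚ) : ℝ) ^ σ) ↔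
    (∃ θ c : ℝ, 0 < θ ∧ 0 < c ∧ ∀ x y : ℤ, x ^ 3 ≠ y ^ 2 →
      c * |(x : ℝ)| ^ θ ≤ |((x : ℝ) ^ 3 - (y : ℝ) ^ 2)|) :=
  -- LANDED p123281 (worker W5): Theorems/IsogenyGlueCongruencePolyHeightOfBoundedPrimesStubHallHalfAllIffWeakHall.lean
  Summit.ABC.ABC.Theorems.PolyHeightOfBoundedPrimes.HallSplit.stub_hallHalfAll_iff_weakHall

/-- **CALIBRATION STUB (`j`-form of the Hall half).** `|c₄|³ = |j|·|Δ|`, `|Δ_min| ≥ 1`: the Hall half is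
equivalent to `|j(W)| ≤ C|Δ_W|^{σ}` on semistable global minimal models (exponents shift by one). -/
theorem stub_hallHalf_iff_polyJ :
    (∃ σ C : ℝ, 0 ≤ σ ∧ ∀ (W : WeierstrassCurve ℚ) [W.IsElliptic] [W.IsGloballyMinimal]
      [NeZero (W.conductorNorm ℤ)], W.IsSemistable ℤ →
        ((|W.c₄| ^ 3 : ℚ) : ℝ) ≤ C * ((|W.Δ| : ℚ) : ℝ) ^ σ) ↔
    (∃ σ C : ℝ, 0 ≤ σ ∧ ∀ (W : WeierstrassCurve ℚ) [W.IsElliptic] [W.IsGloballyMinimal]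
      [NeZero (W.conductorNorm ℤ)], W.IsSemistable ℤ →
        ((|W.j| : ℚ) : ℝ) ≤ C * ((|W.Δ| : ℚ) : ℝ) ^ σ) :=
  -- LANDED p123009 (worker W6): Theorems/IsogenyGlueCongruencePolyHeightOfBoundedPrimesStubHallHalfIffPolyJ.lean
  Summit.ABC.ABC.Theorems.PolyHeightOfBoundedPrimes.HallSplit.stub_hallHalf_iff_polyJ

-- COROLLARY (LANDED p123481 as `Summit.ABC.ABC.Theorems.PolyHeightOfBoundedPrimes.HallSplit.of_finiteHalf_of_weakHall`):
-- `PolySzpiroΔ → WeakHall → PolyHeightOfBoundedPrimes` — the crux follows from the discriminant conjecture for semistable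
-- curves together with the free-exponent Hall inequality. Not restated here (it concludes the crux under unregistered
-- hypotheses, which the skeleton checker rejects; exactly one theorem of this file concludes the crux).

/-- **POSITION STUB (registered via `stub-add`, LANDED p123682): the route target `X` already implies the
Hall half** (`X → P → H →` split). Re-scoping the height waypoint to the finite half therefore moves the Hall
content into the declared abc-strength residual `… → X`, not out of the route. [folklore] -/
theorem stub_hallHalf_of_target :
    SemistableDegreeConjecture → ∃ σ C : ℝ, 0 ≤ σ ∧ ∀ (W : WeierstrassCurve ℚ) [W.IsElliptic]
      [W.IsGloballyMinimal] [NeZero (W.conductorNorm ℤ)], W.IsSemistable ℤ →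
        ((|W.c₄| ^ 3 : ℚ) : ℝ) ≤ C * ((|W.Δ| : ℚ) : ℝ) ^ σ :=
  -- LANDED p123682 (lead): Theorems/IsogenyGlueCongruencePolyHeightOfBoundedPrimesHallSplitPosition.lean
  Summit.ABC.ABC.Theorems.PolyHeightOfBoundedPrimes.HallSplit.stub_hallHalf_of_target

/-! ## Floors (landed by the crux's disprover; cited, not imported, to keep the skeleton on built modules)

Finite half: any witness exponent has `σ > 6` (`Negative.six_lt_of_polySzpiroΔAt`, p121766, Masser 1990).
Hall half: any witness exponent has `σ' ≥ 3/2` (`Negative.three_halves_le_of_polyHallAt`, p121660, Frey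
family `y² = x(x+1)(x+32k)`); conjecturally `σ' ≥ 6` (Danilov, if realised by semistable curves). -/

end Summit.ABC.ABC.Cruxes.PolyHeightOfBoundedPrimes.HallSplit

end
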